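import Literature.InformationTheory.QuantumCodes.LDPCCountingThreshold
import Literature.Probability.LatticeModels.LatticeAnimalsTreeCount
import Mathlib.Analysis.SpecialFunctions.Exp
import Mathlib.Analysis.Complex.ExponentialBounds
import Mathlib.Data.Nat.Choose.Bounds
import Mathlib.Algebra.Order.Field.GeomSum
import HarnessLib

/-!
# The LDPC counting-bound threshold WITH THE PRINTED CONSTANT `p₀ = (2ze)⁻²`
# (Aliferis–Gottesman–Preskill 2008 Lemma 5 / Gottesman 2014 Lemma 2 and Theorem 3, as printed)

Topic `Literature/InformationTheory/QuantumCodes`. Theorem-only file (no definition, no named fact, no sorry);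
qec cell, LIT-2 lane (thresholds & decoders in print), closing the FINDINGS note Q5-2 "LDPC-family threshold
constant: printed KP13/Gottesman14 Thm 3 thresholds use the exact edge/animal counting constant; ours certifies the
weaker `p₀ = (2Δ²)⁻²` … open (sharpening)".

The tree's `ClusterCountingBound.lean` proves the probabilistic core of the Kovalev–Pryadko 2013 / Gottesman 2014
threshold theorem with the crude entropy bound "`≤ Δ^{2(s-1)}` connected `s`-sets through a vertex"
(`card_le_pow_of_isGraphConnected`), whence the certified but weaker threshold `(2Δ²)⁻²`
(`sum_hasDenseCluster_le_geometric`, `LDPCCountingThreshold.sum_decodingFails_le`, Summits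
`ldpc_isThresholdLowerBound`: `1/(4Δ⁴)`). Gottesman's printed proof uses instead

> **Lemma 2** (= [AGP08] Lemma 5). Consider a specific set `S` consisting of `t` nodes in a graph for which every
> node has degree at most `z`. Let `M_z(s,S)` be the number of sets containing `S` and a total of `s` nodes …
> which are a union of connected clusters, each of which contains a node in `S`. Then
> `M_z(s,S) ≤ e^{t-1}(ze)^{s-t}`.

and, in the proof of Theorem 3, only its case `t = 1`: "the number of clusters of size `s` containing a particular
qubit is at most `(ze)^{s-1}`, and therefore the total number of clusters of size `s` is at most `n_i (ze)^{s-1}`",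
concluding with the display

> `Prob(error) ≤ (n_i/(ze)) Σ_{s ≥ d_i} (2ze√p)^s = (n_i/(ze)) (2ze√p)^{d_i}/(1 - 2ze√p)` if `2ze√p < 1` …
> Let `p₀ = (2ze)⁻²`. Then for `p < p₀`, `Prob(error) = n_i/(ze(1 - 2ze√p)) · (p/p₀)^{d_i/2}`.

This file proves exactly these statements, from the tree's EXPLORATION count
`TreeCount.card_le_choose_of_isGraphConnected` (at most `C((z-1)s+1, s-1)` connected `s`-sets through a vertex,
`LatticeAnimalsTreeCount.lean`) and two elementary real inequalities proved here
(`(1 + 1/k)^k ≤ e`, `k^k ≤ k!·e^{k-1}`), which give `C((z-1)s+1, s-1) ≤ (ze)^{s-1}` for all `z, s ≥ 1`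
(`choose_explore_le_mul_exp_pow`; proof: `C(N,k) ≤ N^k/k! ≤ (N/k)^k e^{k-1}` and
`N/k = z(1 + 1/k - 1/z) ≤ z·e^{1/k - 1/z}` for `N = (z-1)(k+1)+1`):

* `card_connected_through_le_mul_exp_pow` — **Lemma 2, case `t = 1`, AS PRINTED**: in a finite graph with all degrees
  `≤ z` (`z ≥ 1`), every family of connected `s`-sets (`s ≥ 1`) through a fixed vertex has at most `(ze)^{s-1}`
  members; `card_connectedOfCard_le_card_mul_exp_pow` — "the total number of clusters of size `s` is at most
  `n (ze)^{s-1}`";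
* `sum_hasDenseCluster_le_printed`, **`sum_hasDenseCluster_le_geometric_printed`** — the union bound of the proof of
  Theorem 3 with this count: for a locally stochastic weight of parameter `p ∈ [0,1]` and `ρ := 2ze√p < 1`,
  `Σ_{E : HasDenseCluster G d E} μ E ≤ n ρ^d/(ze(1 - ρ))` — the displayed `(n_i/(ze)) (2ze√p)^{d_i}/(1 - 2ze√p)`;
* `sum_decodingFails_le_printed`, `sum_decodingFails_bernoulli_le_printed` — **Theorem 3's bound for one error type of
  a CSS (or classical) code under minimum-weight decoding**, local stochastic resp. independent noise, with `z` a degree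
  bound of the check graph (the "adjacency graph of the code"; for an `(r,c)`-LDPC code `z = (r-1)c`,
  `degree_checkGraph_le`): `Σ_{E : decoding fails} μ E ≤ n ρ^d/(ze(1 - ρ))`;
* `two_mul_mul_exp_mul_sqrt_lt_one` — `p < p₀ := (2ze)⁻²` is the printed smallness condition `ρ < 1`, and
  `two_mul_mul_exp_mul_sqrt_eq_sqrt_div` — `ρ = (p/p₀)^{1/2}`, so the bound reads `n_i/(ze(1-ρ)) · (p/p₀)^{d_i/2}`;
* `animalThreshold_le_printedThreshold` — for `z ≥ 3` the printed threshold `(2ze)⁻²` is at least the tree's earlier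
  certified `(2z²)⁻² = 1/(4z⁴)` (so this file SUPERSEDES the earlier constant for every LDPC family of check-graph
  degree `≥ 3`; e.g. the toric check graph, `z = 6`: `1/(12e)² > 1/1065` versus `1/5184`).

HONEST FRAMING: these are still union (Peierls) bounds — LOWER bounds on the threshold, far below the DKLP/DKP15
values certified elsewhere in the tree for CSS codes (`IrreducibleCountingThreshold.lean`: `4(w-1)²p(1-p) < 1`);
their point is that Gottesman's Theorem 3 now holds in the tree with the constant AS PRINTED, for every
bounded-degree check graph and every locally stochastic noise. The general-`t` form of Lemma 2 (unions of clusters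
through a `t`-set), used only in Theorem 4 (syndrome errors), is not needed here and not typed.

## References

* [Gottesman2014] D. Gottesman, *Fault-tolerant quantum computation with constant overhead*, Quantum Inf. Comput.
  14 (2014) 1338–1371, arXiv:1310.2984 — §4: Lemma 2 (p0010 L11–12), Theorem 3 and its proof (p0010 L20 – p0011 L12).
* [AliferisGottesmanPreskill2007] P. Aliferis, D. Gottesman, J. Preskill, *Accuracy threshold for postselected
  quantum computation*, Quantum Inf. Comput. 8 (2008) 181–244, arXiv:quant-ph/0703264 — Lemma 5 (the cluster count
  quoted as Gottesman's Lemma 2).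
* [KovalevPryadko2013] A. A. Kovalev, L. P. Pryadko, Phys. Rev. A 87 (2013) 020304(R), arXiv:1208.2317 — Thm. 3.
* [FawziGrospellierLeverrier2018] O. Fawzi, A. Grospellier, A. Leverrier, STOC 2018, arXiv:1711.08351v2 — Lemma 27
  (the exploration count used here, via `LatticeAnimalsTreeCount.lean`).
-/

open Finset

namespace Literature.InformationTheory.QuantumCodes

open Literature.Probability.LatticeModels

/-! ### Two real inequalities: `(1 + 1/k)^k ≤ e` and `k^k ≤ k!·e^{k-1}` -/

section RealLemmas

/-- `(1 + 1/k)^k ≤ e` for every natural number `k` (from `1 + x ≤ eˣ` at `x = 1/k`). [folklore] -/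
private theorem one_add_one_div_pow_le_exp_one (k : ℕ) : (1 + 1 / (k : ℝ)) ^ k ≤ Real.exp 1 := by
  rcases Nat.eq_zero_or_pos k with rfl | hk
  · have h := Real.add_one_le_exp (1 : ℝ)
    simp only [pow_zero]
    linarith
  · have h1 : 1 + 1 / (k : ℝ) ≤ Real.exp (1 / (k : ℝ)) := by
      have := Real.add_one_le_exp (1 / (k : ℝ)); linarith
    have h0 : 0 ≤ 1 + 1 / (k : ℝ) := by positivity
    have hk0 : (k : ℝ) ≠ 0 := (Nat.cast_pos.2 hk).ne'
    calc (1 + 1 / (k : ℝ)) ^ k ≤ Real.exp (1 / (k : ℝ)) ^ k := pow_le_pow_left₀ h0 h1 k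
      _ = Real.exp ((k : ℝ) * (1 / (k : ℝ))) := (Real.exp_nat_mul _ _).symm
      _ = Real.exp 1 := by rw [mul_one_div_cancel hk0]

/-- `k^k ≤ k! · e^{k-1}` for `k ≥ 1` (induction with `(1 + 1/k)^k ≤ e`; the integral form of Stirling's lower
bound `log k! ≥ k log k - k + 1`). [folklore] -/
private theorem pow_self_le_factorial_mul_exp {k : ℕ} (hk : 1 ≤ k) :
    (k : ℝ) ^ k ≤ (k.factorial : ℝ) * Real.exp ((k : ℝ) - 1) := by
  induction k, hk using Nat.le_induction with
  | base => simp
  | succ k hk ih =>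
    have hkpos : (0 : ℝ) < k := Nat.cast_pos.2 hk
    have hsplit : ((k : ℝ) + 1) ^ k = (k : ℝ) ^ k * (1 + 1 / (k : ℝ)) ^ k := by
      rw [← mul_pow]
      congr 1
      field_simp
    have hk1 : ((k : ℝ) + 1) ^ k ≤ (k.factorial : ℝ) * Real.exp ((k : ℝ) - 1) * Real.exp 1 := by
      rw [hsplit]
      exact mul_le_mul ih (one_add_one_div_pow_le_exp_one k) (by positivity) (by positivity)
    have hexp : Real.exp ((k : ℝ) - 1) * Real.exp 1 = Real.exp (((k + 1 : ℕ) : ℝ) - 1) := by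
      rw [← Real.exp_add]
      congr 1
      push_cast
      ring
    calc (((k + 1 : ℕ) : ℝ)) ^ (k + 1) = ((k : ℝ) + 1) * ((k : ℝ) + 1) ^ k := by push_cast; ring
      _ ≤ ((k : ℝ) + 1) * ((k.factorial : ℝ) * Real.exp ((k : ℝ) - 1) * Real.exp 1) :=
          mul_le_mul_of_nonneg_left hk1 (by positivity)
      _ = (((k + 1).factorial : ℕ) : ℝ) * Real.exp (((k + 1 : ℕ) : ℝ) - 1) := by
          rw [← hexp, Nat.factorial_succ, Nat.cast_mul]
          push_cast
          ring

/-- **The exploration count is at most `(ze)^{s-1}`**: `C((z-1)s+1, s-1) ≤ (ze)^{s-1}` for all `z, s ≥ 1`.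
With `k = s - 1 ≥ 1` and `N = (z-1)s+1 = (z-1)k + z`: `C(N,k) ≤ N^k/k! ≤ (N/k)^k e^{k-1}` and
`N/k = z(1 + 1/k - 1/z) ≤ z e^{1/k - 1/z}`, so `C(N,k) ≤ z^k e^{1 - k/z} e^{k-1} ≤ (ze)^k`. This is the step from the
tree's exploration bound to the printed constant of Gottesman's Lemma 2. [cite: Gottesman2014, Lemma 2 (§4, arXiv p0010 L11–12)] -/
theorem choose_explore_le_mul_exp_pow {z s : ℕ} (hz : 1 ≤ z) (hs : 1 ≤ s) :
    ((((z - 1) * s + 1).choose (s - 1) : ℕ) : ℝ) ≤ ((z : ℝ) * Real.exp 1) ^ (s - 1) := by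
  obtain ⟨k, rfl⟩ : ∃ k, s = k + 1 := ⟨s - 1, by omega⟩
  simp only [Nat.add_sub_cancel]
  rcases Nat.eq_zero_or_pos k with rfl | hk
  · simp
  have hz0 : (0 : ℝ) < z := Nat.cast_pos.2 (by omega)
  have hk0 : (0 : ℝ) < k := Nat.cast_pos.2 hk
  have he0 : (0 : ℝ) < Real.exp 1 := Real.exp_pos 1
  set N : ℕ := (z - 1) * (k + 1) + 1 with hN
  have hNreal : (N : ℝ) = ((z : ℝ) - 1) * k + z := by
    have hz' : ((z - 1 : ℕ) : ℝ) = (z : ℝ) - 1 := by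
      rw [Nat.cast_sub hz, Nat.cast_one]
    rw [hN, Nat.cast_add, Nat.cast_mul, hz']
    push_cast
    ring
  have hN0 : (0 : ℝ) ≤ N := Nat.cast_nonneg N
  -- step 1: `C(N,k) ≤ N^k / k!`
  have h1 : ((N.choose k : ℕ) : ℝ) ≤ (N : ℝ) ^ k / (k.factorial : ℝ) := by
    have := Nat.choose_le_pow_div (α := ℝ) k N
    simpa using this
  -- step 2: `N^k / k! ≤ (N/k)^k e^{k-1}`
  have hfact : (0 : ℝ) < k.factorial := by exact_mod_cast k.factorial_pos
  have hkk : (0 : ℝ) < (k : ℝ) ^ k := by positivity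
  have hinv : 1 / (k.factorial : ℝ) ≤ Real.exp ((k : ℝ) - 1) / (k : ℝ) ^ k := by
    rw [div_le_div_iff₀ hfact hkk, one_mul, mul_comm]
    exact pow_self_le_factorial_mul_exp hk
  have h2 : (N : ℝ) ^ k / (k.factorial : ℝ) ≤ ((N : ℝ) / k) ^ k * Real.exp ((k : ℝ) - 1) := by
    calc (N : ℝ) ^ k / (k.factorial : ℝ) = (N : ℝ) ^ k * (1 / (k.factorial : ℝ)) := by ring
      _ ≤ (N : ℝ) ^ k * (Real.exp ((k : ℝ) - 1) / (k : ℝ) ^ k) :=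
          mul_le_mul_of_nonneg_left hinv (by positivity)
      _ = ((N : ℝ) / k) ^ k * Real.exp ((k : ℝ) - 1) := by rw [div_pow]; ring
  -- step 3: `N/k = z (1 + 1/k - 1/z) ≤ z e^{1/k - 1/z}`
  have hq : (N : ℝ) / k = (z : ℝ) * (1 / (k : ℝ) - 1 / (z : ℝ) + 1) := by
    rw [hNreal]
    field_simp
    ring
  have hq0 : 0 ≤ 1 / (k : ℝ) - 1 / (z : ℝ) + 1 := by
    have h0 : 0 ≤ (N : ℝ) / k := div_nonneg hN0 hk0.le
    rw [hq] at h0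
    by_contra hneg
    push Not at hneg
    have := mul_neg_of_pos_of_neg hz0 hneg
    linarith
  have h3 : ((N : ℝ) / k) ^ k ≤ (z : ℝ) ^ k * Real.exp (1 - (k : ℝ) / z) := by
    rw [hq, mul_pow]
    refine mul_le_mul_of_nonneg_left ?_ (by positivity)
    calc (1 / (k : ℝ) - 1 / (z : ℝ) + 1) ^ k ≤ Real.exp (1 / (k : ℝ) - 1 / (z : ℝ)) ^ k :=
          pow_le_pow_left₀ hq0 (Real.add_one_le_exp _) k
      _ = Real.exp ((k : ℝ) * (1 / (k : ℝ) - 1 / (z : ℝ))) := (Real.exp_nat_mul _ _).symm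
      _ = Real.exp (1 - (k : ℝ) / z) := by
          congr 1
          field_simp
  -- step 4: assemble, `e^{1 - k/z} e^{k-1} = e^{k - k/z} ≤ e^k`
  have h4 : Real.exp (1 - (k : ℝ) / z) * Real.exp ((k : ℝ) - 1) ≤ Real.exp 1 ^ k := by
    rw [← Real.exp_add, ← Real.exp_nat_mul, mul_one]
    refine Real.exp_le_exp.2 ?_
    have : 0 ≤ (k : ℝ) / z := div_nonneg hk0.le hz0.le
    linarith
  calc ((N.choose k : ℕ) : ℝ) ≤ (N : ℝ) ^ k / (k.factorial : ℝ) := h1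
    _ ≤ ((N : ℝ) / k) ^ k * Real.exp ((k : ℝ) - 1) := h2
    _ ≤ (z : ℝ) ^ k * Real.exp (1 - (k : ℝ) / z) * Real.exp ((k : ℝ) - 1) :=
        mul_le_mul_of_nonneg_right h3 (Real.exp_pos _).le
    _ = (z : ℝ) ^ k * (Real.exp (1 - (k : ℝ) / z) * Real.exp ((k : ℝ) - 1)) := by ring
    _ ≤ (z : ℝ) ^ k * Real.exp 1 ^ k := mul_le_mul_of_nonneg_left h4 (by positivity)
    _ = ((z : ℝ) * Real.exp 1) ^ k := by rw [mul_pow]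

end RealLemmas

/-! ### Gottesman's Lemma 2 (case `t = 1`): at most `(ze)^{s-1}` clusters of size `s` through a vertex -/

section Animals

variable {V : Type*} [Fintype V] [DecidableEq V] {G : SimpleGraph V} [DecidableRel G.Adj]

/-- **Gottesman 2014 Lemma 2 (= AGP08 Lemma 5), case `t = 1`, AS PRINTED**: in a finite graph all of whose degrees
are `≤ z` (`z ≥ 1`), every family of connected vertex sets of cardinality `s ≥ 1` that all contain a fixed vertex `v`
has at most `(ze)^{s-1}` members ("the number of clusters of size `s` containing a particular qubit is at most
`(ze)^{s-1}`"). From the tree's exploration count `C((z-1)s+1, s-1)` and `choose_explore_le_mul_exp_pow`.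
[cite: Gottesman2014, Lemma 2 and proof of Thm 3 (§4, arXiv p0010 L11–12, p0011 L1–3)] -/
theorem card_connected_through_le_mul_exp_pow {z : ℕ} (hz : 1 ≤ z) (hdeg : ∀ x, G.degree x ≤ z) (v : V)
    {s : ℕ} (hs : 1 ≤ s) (𝒜 : Finset (Finset V))
    (h𝒜 : ∀ X ∈ 𝒜, IsGraphConnected G X ∧ X.card = s ∧ v ∈ X) :
    (𝒜.card : ℝ) ≤ ((z : ℝ) * Real.exp 1) ^ (s - 1) := by
  have h := TreeCount.card_le_choose_of_isGraphConnected (G := G) hz hdeg v 𝒜 h𝒜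
  calc (𝒜.card : ℝ) ≤ ((((z - 1) * s + 1).choose (s - 1) : ℕ) : ℝ) := by exact_mod_cast h
    _ ≤ ((z : ℝ) * Real.exp 1) ^ (s - 1) := choose_explore_le_mul_exp_pow hz hs

/-- Membership in `connectedOfCard` (restated; the tree's lemma is private). [folklore] -/
private theorem mem_connectedOfCard' {s : ℕ} {S : Finset V} :
    S ∈ connectedOfCard G s ↔ S.card = s ∧ IsGraphConnected G S := by
  simp [connectedOfCard]

/-- **"The total number of clusters of size `s` is at most `n (ze)^{s-1}`"** (Gottesman 2014, proof of Thm 3):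
in a finite graph with all degrees `≤ z` (`z ≥ 1`) the number of connected vertex sets of cardinality `s ≥ 1` is at
most `|V| · (ze)^{s-1}` (each contains a vertex; through a fixed vertex there are at most `(ze)^{s-1}`).
[cite: Gottesman2014, Thm 3 (proof, arXiv p0011 L2–3)] -/
theorem card_connectedOfCard_le_card_mul_exp_pow {z : ℕ} (hz : 1 ≤ z) (hdeg : ∀ x, G.degree x ≤ z)
    {s : ℕ} (hs : 1 ≤ s) :
    ((connectedOfCard G s).card : ℝ) ≤ (Fintype.card V : ℝ) * ((z : ℝ) * Real.exp 1) ^ (s - 1) := by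
  classical
  have hcover : connectedOfCard G s ⊆
      (univ : Finset V).biUnion fun v => (connectedOfCard G s).filter fun S => v ∈ S := by
    intro S hS
    rw [Finset.mem_biUnion]
    have hScard : S.card = s := (mem_connectedOfCard'.1 hS).1
    have hne : S.Nonempty := by rw [← Finset.card_pos, hScard]; exact hs
    obtain ⟨v, hv⟩ := hne
    exact ⟨v, Finset.mem_univ v, Finset.mem_filter.2 ⟨hS, hv⟩⟩
  have h1 : ((connectedOfCard G s).card : ℝ) ≤
      ∑ v ∈ (univ : Finset V), ((((connectedOfCard G s).filter fun S => v ∈ S).card : ℕ) : ℝ) := by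
    have h := (Finset.card_le_card hcover).trans Finset.card_biUnion_le
    exact_mod_cast h
  have h2 : ∀ v ∈ (univ : Finset V),
      ((((connectedOfCard G s).filter fun S => v ∈ S).card : ℕ) : ℝ) ≤ ((z : ℝ) * Real.exp 1) ^ (s - 1) := by
    intro v _
    refine card_connected_through_le_mul_exp_pow hz hdeg v hs _ ?_
    intro X hX
    rw [Finset.mem_filter, mem_connectedOfCard'] at hX
    exact ⟨hX.1.2, hX.1.1, hX.2⟩
  refine h1.trans ((Finset.sum_le_sum h2).trans ?_)
  simp

end Animals

/-! ### The union bound of Theorem 3 with the printed count -/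

section Dense

variable {V : Type*} [Fintype V] [DecidableEq V] {G : SimpleGraph V} [DecidableRel G.Adj]

/-- Sums over a union of events are at most the sum of the sums (nonnegative weights). [folklore] -/
private theorem sum_biUnion_le_sum' {α β : Type*} [DecidableEq β] (T : Finset α) (B : α → Finset β) (W : β → ℝ)
    (hW : ∀ b, 0 ≤ W b) : ∑ b ∈ T.biUnion B, W b ≤ ∑ a ∈ T, ∑ b ∈ B a, W b := by
  classical
  induction T using Finset.induction_on with
  | empty => simp
  | insert a T ha ih =>
    rw [Finset.biUnion_insert, Finset.sum_insert ha]
    have hu : ∑ b ∈ B a ∪ T.biUnion B, W b ≤ ∑ b ∈ B a, W b + ∑ b ∈ T.biUnion B, W b := by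
      rw [← Finset.sum_union_inter]
      have : 0 ≤ ∑ b ∈ B a ∩ T.biUnion B, W b := sum_nonneg fun b _ => hW b
      linarith
    linarith

/-- **The cluster-counting union bound with Gottesman's count**: in a finite graph with all degrees `≤ z` (`z ≥ 1`),
for a locally stochastic weight `μ` with parameter `p ∈ [0,1]` and `d ≥ 1`,
`Σ_{E : HasDenseCluster G d E} μ E ≤ Σ_{s=d}^{|V|} |V| (ze)^{s-1} (2√p)^s` (at most `|V|(ze)^{s-1}` connected `S` of
each size `s`, each "at least half faulty" with weight `≤ 2^s p^{s/2}`).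
[cite: Gottesman2014, Thm 3 (proof, arXiv p0011 L1–5)] -/
theorem sum_hasDenseCluster_le_printed {z : ℕ} (hz : 1 ≤ z) (hdeg : ∀ x, G.degree x ≤ z)
    {μ : Finset V → ℝ} {p : ℝ} (hμ : IsLocallyStochastic μ p) (hp0 : 0 ≤ p) (hp1 : p ≤ 1) {d : ℕ}
    (hd : 1 ≤ d) [DecidablePred (HasDenseCluster G d)] :
    ∑ E ∈ univ.filter (fun E => HasDenseCluster G d E), μ E ≤
      ∑ s ∈ Finset.Icc d (Fintype.card V),
        (Fintype.card V : ℝ) * ((z : ℝ) * Real.exp 1) ^ (s - 1) * (2 * Real.sqrt p) ^ s := by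
  classical
  set clusters : Finset (Finset V) :=
    (Finset.Icc d (Fintype.card V)).biUnion fun s => connectedOfCard G s with hclusters
  have hcover : univ.filter (fun E => HasDenseCluster G d E) ⊆
      clusters.biUnion fun S => univ.filter fun E => S.card ≤ 2 * (S ∩ E).card := by
    intro E hE
    rw [Finset.mem_filter] at hE
    obtain ⟨S, hSconn, hdS, hSE⟩ := hE.2
    rw [Finset.mem_biUnion]
    refine ⟨S, ?_, Finset.mem_filter.2 ⟨Finset.mem_univ _, hSE⟩⟩
    rw [hclusters, Finset.mem_biUnion]
    exact ⟨S.card, Finset.mem_Icc.2 ⟨hdS, Finset.card_le_univ S⟩, mem_connectedOfCard'.2 ⟨rfl, hSconn⟩⟩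
  have h1 : ∑ E ∈ univ.filter (fun E => HasDenseCluster G d E), μ E ≤
      ∑ S ∈ clusters, ∑ E ∈ univ.filter (fun E => S.card ≤ 2 * (S ∩ E).card), μ E :=
    (Finset.sum_le_sum_of_subset_of_nonneg hcover fun E _ _ => hμ.nonneg E).trans
      (sum_biUnion_le_sum' clusters _ μ hμ.nonneg)
  have h2 : ∑ S ∈ clusters, ∑ E ∈ univ.filter (fun E => S.card ≤ 2 * (S ∩ E).card), μ E ≤
      ∑ S ∈ clusters, (2 * Real.sqrt p) ^ S.card :=
    Finset.sum_le_sum fun S _ => sum_filter_dense_le hμ hp0 hp1 S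
  have hr0 : 0 ≤ 2 * Real.sqrt p := mul_nonneg zero_le_two (Real.sqrt_nonneg p)
  have h3 : ∑ S ∈ clusters, (2 * Real.sqrt p) ^ S.card ≤
      ∑ s ∈ Finset.Icc d (Fintype.card V), ∑ S ∈ connectedOfCard G s, (2 * Real.sqrt p) ^ S.card := by
    rw [hclusters]
    exact sum_biUnion_le_sum' _ _ _ fun S => pow_nonneg hr0 _
  have h4 : ∀ s ∈ Finset.Icc d (Fintype.card V),
      ∑ S ∈ connectedOfCard G s, (2 * Real.sqrt p) ^ S.card ≤
        (Fintype.card V : ℝ) * ((z : ℝ) * Real.exp 1) ^ (s - 1) * (2 * Real.sqrt p) ^ s := by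
    intro s hs
    have hs1 : 1 ≤ s := hd.trans (Finset.mem_Icc.1 hs).1
    have hconst : ∑ S ∈ connectedOfCard G s, (2 * Real.sqrt p) ^ S.card =
        ((connectedOfCard G s).card : ℝ) * (2 * Real.sqrt p) ^ s := by
      rw [Finset.sum_congr rfl fun S hS => by rw [(mem_connectedOfCard'.1 hS).1], Finset.sum_const,
        nsmul_eq_mul]
    rw [hconst]
    exact mul_le_mul_of_nonneg_right (card_connectedOfCard_le_card_mul_exp_pow hz hdeg hs1) (pow_nonneg hr0 _)
  exact h1.trans (h2.trans (h3.trans (Finset.sum_le_sum h4)))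

/-- **Gottesman 2014 Theorem 3, the displayed bound, AS PRINTED** (probabilistic half): in a finite graph with all
degrees `≤ z` (`z ≥ 1`), for a locally stochastic weight of parameter `p ∈ [0,1]`, `d ≥ 1` and
`ρ := 2ze√p < 1`, `Σ_{E : HasDenseCluster G d E} μ E ≤ |V| ρ^d/(ze(1 - ρ))` — the display
"`Prob(error) ≤ (n_i/(ze)) Σ_{s ≥ d_i}(2ze√p)^s = (n_i/(ze)) (2ze√p)^{d_i}/(1 - 2ze√p)`".
[cite: Gottesman2014, Thm 3 (proof, displayed equation, arXiv p0011 L5–7)] -/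
theorem sum_hasDenseCluster_le_geometric_printed {z : ℕ} (hz : 1 ≤ z) (hdeg : ∀ x, G.degree x ≤ z)
    {μ : Finset V → ℝ} {p : ℝ} (hμ : IsLocallyStochastic μ p) (hp0 : 0 ≤ p) (hp1 : p ≤ 1) {d : ℕ}
    (hd : 1 ≤ d) [DecidablePred (HasDenseCluster G d)]
    (hρ : 2 * ((z : ℝ) * Real.exp 1) * Real.sqrt p < 1) :
    ∑ E ∈ univ.filter (fun E => HasDenseCluster G d E), μ E ≤
      (Fintype.card V : ℝ) * (2 * ((z : ℝ) * Real.exp 1) * Real.sqrt p) ^ d /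
        (((z : ℝ) * Real.exp 1) * (1 - 2 * ((z : ℝ) * Real.exp 1) * Real.sqrt p)) := by
  classical
  set K : ℝ := (z : ℝ) * Real.exp 1 with hKdef
  set ρ : ℝ := 2 * K * Real.sqrt p with hρdef
  have hK0 : 0 < K := by rw [hKdef]; exact mul_pos (Nat.cast_pos.2 (by omega)) (Real.exp_pos 1)
  have hρ0 : 0 ≤ ρ := by rw [hρdef]; positivity
  have hn0 : (0 : ℝ) ≤ Fintype.card V := Nat.cast_nonneg _
  refine (sum_hasDenseCluster_le_printed hz hdeg hμ hp0 hp1 hd).trans ?_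
  have hterm : ∀ s ∈ Finset.Icc d (Fintype.card V),
      (Fintype.card V : ℝ) * K ^ (s - 1) * (2 * Real.sqrt p) ^ s = (Fintype.card V : ℝ) / K * ρ ^ s := by
    intro s hs
    have hs1 : 1 ≤ s := hd.trans (Finset.mem_Icc.1 hs).1
    obtain ⟨t, rfl⟩ : ∃ t, s = t + 1 := ⟨s - 1, by omega⟩
    simp only [Nat.add_sub_cancel, hρdef]
    field_simp
    ring
  rw [Finset.sum_congr rfl hterm, ← Finset.mul_sum]
  have hgeom : ∑ s ∈ Finset.Icc d (Fintype.card V), ρ ^ s ≤ ρ ^ d / (1 - ρ) := by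
    have hIcc : Finset.Icc d (Fintype.card V) = Finset.Ico d (Fintype.card V + 1) := by
      ext s; simp only [Finset.mem_Icc, Finset.mem_Ico]; omega
    rw [hIcc]
    exact geom_sum_Ico_le_of_lt_one hρ0 hρ
  calc (Fintype.card V : ℝ) / K * ∑ s ∈ Finset.Icc d (Fintype.card V), ρ ^ s
      ≤ (Fintype.card V : ℝ) / K * (ρ ^ d / (1 - ρ)) :=
        mul_le_mul_of_nonneg_left hgeom (div_nonneg hn0 hK0.le)
    _ = (Fintype.card V : ℝ) * ρ ^ d / (K * (1 - ρ)) := by rw [div_mul_div_comm]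

end Dense

/-! ### The threshold `p₀ = (2ze)⁻²` -/

section Threshold

/-- **`p < p₀ = (2ze)⁻²` implies the printed smallness condition `2ze√p < 1`** (`z ≥ 1`; for `p < 0` the
left side is `0`).
[cite: Gottesman2014, Thm 3 (proof: "if 2ze√p < 1 … Let p₀ = (2ze)⁻²")] -/
theorem two_mul_mul_exp_mul_sqrt_lt_one {z : ℕ} (hz : 1 ≤ z) {p : ℝ}
    (hp : p < 1 / (2 * (z : ℝ) * Real.exp 1) ^ 2) :
    2 * ((z : ℝ) * Real.exp 1) * Real.sqrt p < 1 := by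
  have hK : 0 < 2 * (z : ℝ) * Real.exp 1 := by
    have : (0 : ℝ) < z := Nat.cast_pos.2 (by omega)
    positivity
  have hsq : Real.sqrt p < 1 / (2 * (z : ℝ) * Real.exp 1) := by
    rw [Real.sqrt_lt' (by positivity)]
    calc p < 1 / (2 * (z : ℝ) * Real.exp 1) ^ 2 := hp
      _ = (1 / (2 * (z : ℝ) * Real.exp 1)) ^ 2 := by rw [one_div_pow]
  calc 2 * ((z : ℝ) * Real.exp 1) * Real.sqrt p = (2 * (z : ℝ) * Real.exp 1) * Real.sqrt p := by ring
    _ < (2 * (z : ℝ) * Real.exp 1) * (1 / (2 * (z : ℝ) * Real.exp 1)) := by gcongr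
    _ = 1 := by field_simp

/-- `ρ = 2ze√p = (p/p₀)^{1/2}` with `p₀ = (2ze)⁻²` (both sides vanish for `p ≤ 0`): the bound of
`sum_hasDenseCluster_le_geometric_printed` is Gottesman's "`n_i/(ze(1 - 2ze√p)) · (p/p₀)^{d_i/2}`".
[cite: Gottesman2014, Thm 3 (last display of the proof)] -/
theorem two_mul_mul_exp_mul_sqrt_eq_sqrt_div (z : ℕ) (p : ℝ) :
    2 * ((z : ℝ) * Real.exp 1) * Real.sqrt p = Real.sqrt (p / (1 / (2 * (z : ℝ) * Real.exp 1) ^ 2)) := by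
  have hK : 0 ≤ 2 * (z : ℝ) * Real.exp 1 := by positivity
  rw [div_div_eq_mul_div, div_one, Real.sqrt_mul' p (sq_nonneg _), Real.sqrt_sq hK]
  ring

/-- **The printed threshold supersedes the tree's earlier constant for degree `≥ 3`**: for `z ≥ 3`,
`(2z²)⁻² = 1/(4z⁴) ≤ (2ze)⁻²` (since `e ≤ 3 ≤ z`). [cite: Gottesman2014, Thm 3 (p₀ = (2ze)⁻²)] -/
theorem animalThreshold_le_printedThreshold {z : ℕ} (hz : 3 ≤ z) :
    1 / (4 * (z : ℝ) ^ 4) ≤ 1 / (2 * (z : ℝ) * Real.exp 1) ^ 2 := by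
  have hz3 : (3 : ℝ) ≤ z := by exact_mod_cast hz
  have he3 : Real.exp 1 ≤ 3 := by
    have := Real.exp_one_lt_d9
    linarith
  have he0 : 0 < Real.exp 1 := Real.exp_pos 1
  have hz0 : (0 : ℝ) < z := by linarith
  rw [div_le_div_iff₀ (by positivity) (by positivity), one_mul, one_mul]
  have hez : Real.exp 1 ≤ z := he3.trans hz3
  calc (2 * (z : ℝ) * Real.exp 1) ^ 2 = 4 * (z : ℝ) ^ 2 * Real.exp 1 ^ 2 := by ring
    _ ≤ 4 * (z : ℝ) ^ 2 * (z : ℝ) ^ 2 := by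
        refine mul_le_mul_of_nonneg_left ?_ (by positivity)
        exact pow_le_pow_left₀ he0.le hez 2
    _ = 4 * (z : ℝ) ^ 4 := by ring

/-- Numerical orientation for the toric check graph (`z = 6`): the printed threshold `(12e)⁻²` exceeds `1/1065`
(versus the earlier certified `1/5184`). [cite: Gottesman2014, Thm 3 (p₀ = (2ze)⁻²)] -/
theorem printedThreshold_six_gt : (1 : ℝ) / 1065 < 1 / (2 * (6 : ℝ) * Real.exp 1) ^ 2 := by
  have he : Real.exp 1 < 2.7182818286 := Real.exp_one_lt_d9
  have he0 : 0 < Real.exp 1 := Real.exp_pos 1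
  rw [div_lt_div_iff₀ (by norm_num) (by positivity), one_mul, one_mul]
  nlinarith [he, he0]

end Threshold

/-! ### Theorem 3 for one error type of a code under minimum-weight decoding -/

section Codes

open Matrix

variable {m n : ℕ}

/-- **Gottesman 2014 Theorem 3 with the printed constant, finite-length form** (one error type of a CSS code, or a
classical code with `SX = ⊥`): check matrix `H`, trivial errors `SX`, `1 ≤ d ≤ ‖x‖` for all `x ∈ ker H ∖ SX`, check
graph ("adjacency graph of the code") with all degrees `≤ z` (`z ≥ 1`; `z = (r-1)c` for an `(r,c)`-LDPC code,
`degree_checkGraph_le`), ANY minimum-weight decoder `D`, a locally stochastic error weight `μ` of parameter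
`p ∈ [0,1]` with `ρ := 2ze√p < 1` (i.e. `p < p₀ = (2ze)⁻²`). Then the total weight of the failing error sets is at
most `n ρ^d/(ze(1 - ρ)) = n/(ze(1-ρ)) · (p/p₀)^{d/2}`. [cite: Gottesman2014, Thm 3 (§4, arXiv p0010 L20 – p0011 L12)] -/
theorem sum_decodingFails_le_printed (H : Matrix (Fin m) (Fin n) (ZMod 2))
    (SX : Submodule (ZMod 2) (Fin n → ZMod 2)) {D : (Fin m → ZMod 2) → (Fin n → ZMod 2)}
    (hD : IsMinWeightDecoder H D) [DecidablePred (DecodingFails H SX D)] {d : ℕ} (hd1 : 1 ≤ d)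
    (hd : ∀ x : Fin n → ZMod 2, H *ᵥ x = 0 → x ∉ SX → d ≤ hammingNorm x) {z : ℕ} (hz : 1 ≤ z)
    [DecidableRel (checkGraph H).Adj] (hdeg : ∀ v, (checkGraph H).degree v ≤ z)
    {μ : Finset (Fin n) → ℝ} {p : ℝ} (hμ : IsLocallyStochastic μ p) (hp0 : 0 ≤ p) (hp1 : p ≤ 1)
    (hρ : 2 * ((z : ℝ) * Real.exp 1) * Real.sqrt p < 1) :
    ∑ E ∈ univ.filter (fun E => DecodingFails H SX D E), μ E ≤
      (n : ℝ) * (2 * ((z : ℝ) * Real.exp 1) * Real.sqrt p) ^ d /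
        (((z : ℝ) * Real.exp 1) * (1 - 2 * ((z : ℝ) * Real.exp 1) * Real.sqrt p)) := by
  classical
  have hsub : univ.filter (fun E => DecodingFails H SX D E) ⊆
      univ.filter (fun E => HasDenseCluster (checkGraph H) d E) := by
    intro E hE
    rw [Finset.mem_filter] at hE ⊢
    exact ⟨hE.1, hasDenseCluster_of_decodingFails H SX hD hd hE.2⟩
  have h1 : ∑ E ∈ univ.filter (fun E => DecodingFails H SX D E), μ E ≤
      ∑ E ∈ univ.filter (fun E => HasDenseCluster (checkGraph H) d E), μ E :=
    Finset.sum_le_sum_of_subset_of_nonneg hsub fun E _ _ => hμ.nonneg E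
  have h2 := sum_hasDenseCluster_le_geometric_printed (G := checkGraph H) hz hdeg hμ hp0 hp1 hd1 hρ
  rw [Fintype.card_fin] at h2
  exact h1.trans h2

/-- The same bound for the **i.i.d. model** (`bernoulliWeight p`, e.g. independent `X`-errors on a CSS code;
Kovalev–Pryadko 2013 Thm. 3's channel), printed constant. [cite: Gottesman2014, Thm 3] [cite: KovalevPryadko2013, Thm 3] -/
theorem sum_decodingFails_bernoulli_le_printed (H : Matrix (Fin m) (Fin n) (ZMod 2))
    (SX : Submodule (ZMod 2) (Fin n → ZMod 2)) {D : (Fin m → ZMod 2) → (Fin n → ZMod 2)}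
    (hD : IsMinWeightDecoder H D) [DecidablePred (DecodingFails H SX D)] {d : ℕ} (hd1 : 1 ≤ d)
    (hd : ∀ x : Fin n → ZMod 2, H *ᵥ x = 0 → x ∉ SX → d ≤ hammingNorm x) {z : ℕ} (hz : 1 ≤ z)
    [DecidableRel (checkGraph H).Adj] (hdeg : ∀ v, (checkGraph H).degree v ≤ z) {p : ℝ} (hp0 : 0 ≤ p)
    (hp1 : p ≤ 1) (hρ : 2 * ((z : ℝ) * Real.exp 1) * Real.sqrt p < 1) :
    ∑ E ∈ univ.filter (fun E => DecodingFails H SX D E), bernoulliWeight p E ≤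
      (n : ℝ) * (2 * ((z : ℝ) * Real.exp 1) * Real.sqrt p) ^ d /
        (((z : ℝ) * Real.exp 1) * (1 - 2 * ((z : ℝ) * Real.exp 1) * Real.sqrt p)) :=
  sum_decodingFails_le_printed H SX hD hd1 hd hz hdeg (isLocallyStochastic_bernoulliWeight hp0 hp1) hp0 hp1 hρ

end Codes

end Literature.InformationTheory.QuantumCodes
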